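import Summits.ABC.IUTFork.Repair.RHOffSigmaTolerance
import Summits.ABC.ABC.Theorems.IUTThetaPilotThetaPartIIULineCapstone
import HarnessLib

/-!
# R-H ROUND 2, Q2 — the abc END of «S restricted to Σ ⇒ Cor. 3.12 up to B ⇒ abc»: an off-Σ bound `B ≤ τ(P, l) := (l+1)·d*·l/6`
# (`d* = 2¹²·3³·5·d_mod`) COSTS NOTHING — [IUTchIV] Thm. 1.10's display, Cor. 2.2 (ii) and `ABC` follow with print's OWN constants

Record + proof file of the abc-iut cell (D-0079 RESCUE sub-cell R-H «local-height programme», rung LADDER-ABC:A2.RESCUE.H; ROUND 2 tranche 1,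
director-abc g3 2026-08-26T19:46:32Z item (3) «rh-typ-5 ← rows 5 + 16: Q2», seat abc-iut-rh-typ-5 gen 3; ROUND2/START-HERE.md v1.1 §1 Q2, §2).
TAKES NO SIDE on [IUTchIII] Cor. 3.12 or on any author; every IUT sentence quoted is [claim: Mochizuki2012, status: disputed]; typed ≠ proved;
instantiated ≠ endorsed. Consumed BY NAME, nothing re-typed: abc-iut-rh2-xi-1's `Repair.RH.OffSigma` (p-landed `RHOffSigmaTolerance`: the shape
«Cor. 3.12 up to `B`» `T.negAbsLogQ − B ≤ T.negLogTheta` at a genuine Θ-volume datum, `logQAvoid_le_of_cor312UpTo`, the tolerance predicate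
`OffSigmaTolerance κ A T B := B ≤ κ·T.gap + A`), abc-iut-S-d2's `ThetaPartIIDisplay` (Step (viii) at a point, `thm110Legendre_of_pointwise`),
abc-iut-c312-8 / S3's (U)-line capstone (`ThetaPartII.hullVolume_of_hullRegime`, `stub_thetaData`, the route's `closes` with the PROVED
`genEllTwo_holds`, `JInvWlog_proof`).

THE QUESTION THIS FILE SETTLES (ROUND2/START-HERE §1 Q2, second arrow «Cor312_weak D ε → abc_with_constant (1+ε')»; xi-1's §3 left the
«κ = 0, A of print's shape» case to re-enter `B_III` with `12 ↦ 12+a`, `52 ↦ 52+b`): **how large an ADDITIVE off-Σ bound `B` does the chain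
Cor. 3.12 ⇒ Thm. 1.10 ⇒ Cor. 2.2 (ii) ⇒ abc absorb with NO change of ANY constant?** ANSWER (kernel): every `B ≤ τ(P, l)`,
`τ(P, l) := ((l+1)/6)·(2¹²·3³·5·d_mod)·l` (`displayTolerance`). Reason: print's Step (viii) ([IUTchIV] pp. 30–31) rounds
`(20/3)·log(d*·l)·π(d*·l) ≤ (80/9)·(d*·l + η_prm)` (Prop. 1.6, PROVED `log_mul_primeCounting_le_of_isEtaPrm`) and `2·log l + 56 ≤ (4/9)·(d*·l + η_prm)`
(`Thm110Numerics.stepviii_absorb`) into the bracket's `10·(d*·l + η_prm)`; the unused `(6/9)·(d*·l + η_prm) ≥ (2/3)·d*·l`, times the squeeze's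
factor `(l+1)/4`, is exactly `τ(P, l)`. So:
* **`display_of_squeezeIII_upTo`** — the squeeze with constant `B_III` PLUS any `s ≤ τ(P, l)` STILL gives `Cor22.Display P l η` for every
  `IsEtaPrm η` (Step (viii) redone with the slack inside the bracket; `C_Θ ≥ −1` and the last paragraph verbatim);
* `thm110Legendre_of_squeezeIII_upTo`, `ThetaPartII_of_squeezeIII_upTo` — [IUTchIV] Thm. 1.10 (Legendre form) and the crux `ThetaPartII`
  (stmt-ABC-19678) BY NAME from the squeeze weakened by `τ`;
* **`ABC_of_cor312UpTo_of_hullRegime`** — «Cor. 3.12 up to `τ(P, l)` at every genuine Θ-volume datum of every admissible `(P, l)`»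
  (`∀ T, T.negAbsLogQ − τ(P,l) ≤ T.negLogTheta`, HYPOTHESIS) ∧ the off-regime hull estimate `hreg` (VERBATIM the binder of
  `ThetaPartII.ABC_of_cor312_of_hullRegime`) ⟹ `ABC`; since `T.Cor312Of` implies the weakened form (`τ ≥ 0`), this IS the certificate of record
  with a strictly WEAKER upstream hypothesis (`T.Cor312Of` gives `T.negAbsLogQ − τ ≤ T.negLogTheta` since `τ ≥ 0`, `displayTolerance_nonneg`);
* **`ABC_of_offSigmaTolerance_zero_of_hullRegime`** — in xi-1's currency: at every admissible datum SOME off-Σ bound `B` with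
  «Cor. 3.12 up to `B`» and `OffSigmaTolerance 0 (τ(P,l)) T B` ⟹ `ABC` — the ADDITIVE tolerance `A = τ(P, l)` is FREE downstream.
READING FOR THE KEPT ROWS (Q2 × Q3 interface): rh2-q2-eq's `RH.SigmaLicence.statementUpTo_offRemainder_of_licenceOn` / rh-typ-12's
`RHSlotReach.negLogQ_add_offWindow_le_negLogTheta_of_licenceOn` / xi-1's `negLogQ_sub_le_negLogTheta_of_compatHullOn` give «Cor. 3.12 up to
`D_off(Σ_row)`» from «S_H on `Σ_row`» alone; hence **abc with print's constants follows from S_H on `Σ_row` at every admissible datum whose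
off-`Σ_row` deficit is `≤ τ(P, l)`**. In genuine currency the deficit of a cell is at most its Θ–q floor `(j²−1)·(−qLocal_{j,v_ℚ})`
(hull ⊇ (Ind3)-region, abc-iut-C-cert-1's `PinnedHonestReal.scaled_settingPrVolSharp`), so for a PLACE-stratum (row 5: off-Σ₅ = the wild /
non-band bad places) the condition reads `((l²+l−12)/(24l))·log(q_{off Σ}) ≤ τ(P,l)`, i.e. `log(q_{off Σ}) ≤ 4·d*·l²(l+1)/(l²+l−12) ≈ 2.2·10⁶·d_mod·l`
— the number rh2-q3-num / rh-kit-1 compare with the off-Σ local heights of genuine data along Cor. 2.2's `l`. Beyond `τ` a bound of print's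
shape `((l+1)/4)·(a·d_mod/l·L + b)` needs Step (viii) AND abc-iut-S3's `Cor22.partII_of_thm110Legendre` re-run with `20 ↦ 20 + c` (rh2-q2-cond's
constant-loss certificate) — NOT done here. HONEST FRAMING: locates / conditionally verifies; NOT an abc claim; nothing asserts that Cor. 3.12,
weakened or not, holds at any datum. [cite: Mochizuki2012, IUTchIV Thm. 1.10 Step (viii) pp. 30–31; Prop. 1.6 p. 16; Cor. 2.2 (ii) pp. 41–48]
[cite: Mochizuki2012, IUTchIII Cor. 3.12 p. 174] [claim: Mochizuki2012, status: disputed]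
-/

noncomputable section

namespace Summit.ABC.IUTFork.Repair.RH.OffSigmaDisplay

open Literature.IUT.LogVolume Literature.NumberTheory.DiophantineGeometry.GenEll Literature.IUT.HodgeTheaters
open Summit.ABC.ABC.Theorems Summit.ABC.ABC.Theorems.ThetaPartIIDisplay Summit.ABC.IUTFork.Repair.RH.OffSigma
open NumberField IsDedekindDomain

/-! ## §1. The display tolerance `τ(P, l)` -/

/-- **The DISPLAY TOLERANCE `τ(P, l) := ((l+1)/6)·(2¹²·3³·5·d_mod)·l`** — the additive slack, in Cor. 3.12 / squeeze units, that print's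
Step (viii) roundings of [IUTchIV] Thm. 1.10 leave unused (`(2/3)·d*·l` inside the bracket, times the squeeze's `(l+1)/4`). An explicit real
number; no claim. [cite: Mochizuki2012, IUTchIV Thm. 1.10 Step (viii) p. 30–31] -/
def displayTolerance (P : NFPoint) (l : ℕ) : ℝ :=
  ((l : ℝ) + 1) / 6 * ((((2 ^ 12 * 3 ^ 3 * 5 * Cor22.dmod P : ℕ) : ℝ)) * l)

/-- `τ(P, l) ≥ 0`. [folklore] -/
theorem displayTolerance_nonneg (P : NFPoint) (l : ℕ) : 0 ≤ displayTolerance P l := by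
  unfold displayTolerance
  positivity

/-- `τ(P, l)` in the squeeze's bracket form: `τ = ((l+1)/4)·((2/3)·d*·l)`. [folklore] -/
theorem displayTolerance_eq (P : NFPoint) (l : ℕ) :
    displayTolerance P l = ((l : ℝ) + 1) / 4 * (2 / 3 * ((((2 ^ 12 * 3 ^ 3 * 5 * Cor22.dmod P : ℕ) : ℝ)) * l)) := by
  unfold displayTolerance
  ring

/-- **In xi-1's currency**: `OffSigmaTolerance 0 (τ(P,l)) T B` is `B ≤ τ(P, l)`. [folklore] -/
theorem offSigmaTolerance_zero_displayTolerance_iff {P : NFPoint} {l : ℕ} (T : Cor22.ThetaVolumeDatumAt P l) (B : ℝ) :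
    OffSigmaTolerance 0 (displayTolerance P l) T B ↔ B ≤ displayTolerance P l := by
  rw [offSigmaTolerance_iff, zero_mul, zero_add]

/-! ## §2. Step (viii) of [IUTchIV] Thm. 1.10 at a point, constant `B_III`, WITH AN ADDITIVE SLACK `s ≤ τ(P, l)` -/

/-- **Step (viii) at a point with slack** (print's Step (iii) FINAL display p. 26 substituted into Step (v)'s sum p. 29, as in
abc-iut-S-d2's `ThetaPartIIDisplay.display_of_squeezeIII`): the squeeze with `B_III(P,l)` PLUS ANY `s ≤ τ(P, l)`, `l ≥ 5` prime, `l ≠ 5`,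
`IsEtaPrm η_prm` ⟹ `Cor22.Display P l η_prm` UNCHANGED. Proof = print's Step (viii) (pp. 30–31) at the numerics of the point: Step (vii)
`(l+5)/4·log π ≤ (l+1)/4·4`, `(l+1)/4·(1/6)·(1 − 12/l²) ≤ (l+1)/24 − 1/(2l)`, Prop. 1.6 `log(d*·l)·π(d*·l) ≤ (4/3)·(d*·l + η_prm)` (PROVED,
`log_mul_primeCounting_le_of_isEtaPrm`), `2·log l + 56 ≤ (1/3)·(4/3)·(d*·l + η_prm)` (`Thm110Numerics.stepviii_absorb`) — these use
`(84/9)·(d*·l + η)` of the bracket's `10·(d*·l + η)`; the slack `s ≤ (l+1)/4·(2/3)·d*·l ≤ (l+1)/4·(6/9)·(d*·l + η)` fills the rest, so the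
braces of `C_Θ` are still `≥ 0`, `C_Θ ≥ −1`, and the last paragraph (`Thm110Numerics.display_of_neg_one_le_CTheta`, `l ≥ 7`) applies verbatim.
Pure arithmetic; no side taken. [cite: Mochizuki2012, IUTchIV Thm. 1.10 Step (viii) p. 30–31] [claim: Mochizuki2012, status: disputed] -/
theorem display_of_squeezeIII_upTo {P : NFPoint} {l : ℕ} (hl : l.Prime) (h5 : 5 ≤ l) (hne : l ≠ 5) {η : ℝ}
    (hη : IsEtaPrm η) {s : ℝ} (hs : s ≤ displayTolerance P l)
    (hineq : (((l : ℝ) + 1) / 24 - 1 / (2 * l)) * Cor22.logQAvoid P {2, l} ≤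
      ((l : ℝ) + 1) / 4 *
          ((1 + 12 * (Cor22.dmod P : ℝ) / l) * (P.logDiff + Cor22.logCondAvoid P {2, l})
            + 2 * Real.log l + 52
            + 20 / 3 * Real.log (((2 ^ 12 * 3 ^ 3 * 5 * Cor22.dmod P : ℕ) : ℝ) * (l : ℝ))
              * (Nat.primeCounting (2 ^ 12 * 3 ^ 3 * 5 * Cor22.dmod P * l) : ℝ))
        + ThetaVolumeInput.archLogTheta l + s) :
    Cor22.Display P l η := by
  have hLD : 0 ≤ P.logDiff := P.logDiff_nonneg
  have hLC : 0 ≤ Cor22.logCondAvoid P {2, l} := Cor22.logCondAvoid_nonneg P {2, l}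
  have hl1 : (1 : ℝ) ≤ l := by exact_mod_cast hl.one_lt.le
  have hl0 : (0 : ℝ) < l := by linarith
  have hd1 : (1 : ℝ) ≤ (Cor22.dmod P : ℝ) := by exact_mod_cast Cor22.dmod_pos P
  have hη0 : 0 < η := hη.1
  have hs' : s ≤ ((l : ℝ) + 1) / 4 * (2 / 3 * ((((2 ^ 12 * 3 ^ 3 * 5 * Cor22.dmod P : ℕ) : ℝ)) * l)) := by
    rw [← displayTolerance_eq]; exact hs
  by_cases hq : 0 < Cor22.logQAvoid P {2, l}
  swap
  · -- `log(q) ≤ 0`: the display is trivial (its right-hand side is nonnegative)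
    have hq' : Cor22.logQAvoid P {2, l} ≤ 0 := not_lt.1 hq
    unfold Cor22.Display
    have h1 : 0 ≤ (1 + 20 * (Cor22.dmod P : ℝ) / l) * (P.logDiff + Cor22.logCondAvoid P {2, l}) := by
      positivity
    have h2 : 0 ≤ 20 * (2 ^ 12 * 3 ^ 3 * 5 * (Cor22.dmod P : ℝ) * l + η) := by positivity
    linarith
  -- the numerics of the point, with `−|log(Θ)| := −|log(q)|`
  let X : Thm110Numerics :=
    { l := l, prime_l := hl, five_le_l := h5
      dmod := Cor22.dmod P, one_le_dmod := Cor22.dmod_pos P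
      emod := Cor22.dmod P, one_le_emod := Cor22.dmod_pos P, emod_le_dmod := le_rfl
      etaPrm := η, etaPrm_pos := hη.1
      logDiffTpd := P.logDiff, logDiffTpd_nonneg := hLD
      logCondTpd := Cor22.logCondAvoid P {2, l}, logCondTpd_nonneg := hLC
      logDiffF := P.logDiff, logDiffF_nonneg := hLD
      logCondF := Cor22.logCondAvoid P {2, l}, logCondF_nonneg := hLC
      logq := Cor22.logQAvoid P {2, l}, logq_pos := hq
      negLogTheta := -(Cor22.logQAvoid P {2, l} / (2 * (l : ℝ))) }
  have h7 : 7 ≤ X.l := X.seven_le_l_of_ne_five hne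
  -- Prop. 1.6 (the prime number theorem, proved in the tree): `log(d*·l)·π(d*·l) ≤ (4/3)·(d*·l + η)`
  have hpnt : Real.log (((2 ^ 12 * 3 ^ 3 * 5 * Cor22.dmod P : ℕ) : ℝ) * (l : ℝ))
      * (Nat.primeCounting (2 ^ 12 * 3 ^ 3 * 5 * Cor22.dmod P * l) : ℝ) ≤
      4 / 3 * ((((2 ^ 12 * 3 ^ 3 * 5 * Cor22.dmod P : ℕ) : ℝ)) * l + η) := by
    have h0 : (0 : ℝ) ≤ (((2 ^ 12 * 3 ^ 3 * 5 * Cor22.dmod P : ℕ) : ℝ)) * l := by positivity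
    have h2 := log_mul_primeCounting_le_of_isEtaPrm hη h0
    rwa [show ⌊(((2 ^ 12 * 3 ^ 3 * 5 * Cor22.dmod P : ℕ) : ℝ)) * (l : ℝ)⌋₊ =
        2 ^ 12 * 3 ^ 3 * 5 * Cor22.dmod P * l by
      exact_mod_cast Nat.floor_natCast (2 ^ 12 * 3 ^ 3 * 5 * Cor22.dmod P * l)] at h2
  -- Step (viii): `2·log l + 56 ≤ (1/3)·(4/3)·(d*·l + η)` (abc-iut-S3's `stepviii_absorb`)
  have habs : 2 * Real.log (l : ℝ) + 56 ≤
      1 / 3 * (4 / 3) * ((((2 ^ 12 * 3 ^ 3 * 5 * Cor22.dmod P : ℕ) : ℝ)) * l + η) :=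
    Thm110Numerics.stepviii_absorb X
  -- Step (vii): `(l+5)/4·log π ≤ (l+1)/4·4`
  have harch : ThetaVolumeInput.archLogTheta l ≤ ((l : ℝ) + 1) / 4 * 4 := by
    unfold ThetaVolumeInput.archLogTheta
    have hpi := log_pi_le_two
    have hl5 : (5 : ℝ) ≤ l := by exact_mod_cast h5
    have h1 : ((l : ℝ) + 5) / 4 * Real.log Real.pi ≤ ((l : ℝ) + 5) / 4 * 2 :=
      mul_le_mul_of_nonneg_left hpi (by positivity)
    linarith
  -- the slack is dominated by the unused `(2/3)·(d*·l + η)` of the bracket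
  have hE0le : (((2 ^ 12 * 3 ^ 3 * 5 * Cor22.dmod P : ℕ) : ℝ)) * l ≤
      (((2 ^ 12 * 3 ^ 3 * 5 * Cor22.dmod P : ℕ) : ℝ)) * l + η := by linarith
  -- the braces of `C_Θ` are nonnegative
  have hbr : 0 ≤ X.bracket := by
    show 0 ≤ (1 + 12 * (Cor22.dmod P : ℝ) / l) * (P.logDiff + Cor22.logCondAvoid P {2, l})
      + 10 * ((((2 ^ 12 * 3 ^ 3 * 5 * Cor22.dmod P : ℕ) : ℝ)) * l + η)
      - 1 / 6 * (1 - 12 / ((l : ℝ) ^ 2)) * Cor22.logQAvoid P {2, l}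
    have hc : (0 : ℝ) < ((l : ℝ) + 1) / 4 := by positivity
    -- hypothesis + Step (vii) + the slack bound
    have h1 : (((l : ℝ) + 1) / 24 - 1 / (2 * l)) * Cor22.logQAvoid P {2, l} ≤
        ((l : ℝ) + 1) / 4 *
          ((1 + 12 * (Cor22.dmod P : ℝ) / l) * (P.logDiff + Cor22.logCondAvoid P {2, l})
            + 2 * Real.log l + 52
            + 20 / 3 * Real.log (((2 ^ 12 * 3 ^ 3 * 5 * Cor22.dmod P : ℕ) : ℝ) * (l : ℝ))
              * (Nat.primeCounting (2 ^ 12 * 3 ^ 3 * 5 * Cor22.dmod P * l) : ℝ) + 4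
            + 2 / 3 * ((((2 ^ 12 * 3 ^ 3 * 5 * Cor22.dmod P : ℕ) : ℝ)) * l)) := by
      have e : ((l : ℝ) + 1) / 4 *
          ((1 + 12 * (Cor22.dmod P : ℝ) / l) * (P.logDiff + Cor22.logCondAvoid P {2, l})
            + 2 * Real.log l + 52
            + 20 / 3 * Real.log (((2 ^ 12 * 3 ^ 3 * 5 * Cor22.dmod P : ℕ) : ℝ) * (l : ℝ))
              * (Nat.primeCounting (2 ^ 12 * 3 ^ 3 * 5 * Cor22.dmod P * l) : ℝ) + 4
            + 2 / 3 * ((((2 ^ 12 * 3 ^ 3 * 5 * Cor22.dmod P : ℕ) : ℝ)) * l)) =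
          ((l : ℝ) + 1) / 4 *
          ((1 + 12 * (Cor22.dmod P : ℝ) / l) * (P.logDiff + Cor22.logCondAvoid P {2, l})
            + 2 * Real.log l + 52
            + 20 / 3 * Real.log (((2 ^ 12 * 3 ^ 3 * 5 * Cor22.dmod P : ℕ) : ℝ) * (l : ℝ))
              * (Nat.primeCounting (2 ^ 12 * 3 ^ 3 * 5 * Cor22.dmod P * l) : ℝ))
          + ((l : ℝ) + 1) / 4 * 4
          + ((l : ℝ) + 1) / 4 * (2 / 3 * ((((2 ^ 12 * 3 ^ 3 * 5 * Cor22.dmod P : ℕ) : ℝ)) * l)) := by ring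
      rw [e]
      linarith
    -- `(l+1)/4·(1/6)·(1 − 12/l²) ≤ (l+1)/24 − 1/(2l)`
    have hcoef : ((l : ℝ) + 1) / 4 * (1 / 6 * (1 - 12 / ((l : ℝ) ^ 2))) ≤
        ((l : ℝ) + 1) / 24 - 1 / (2 * l) := by
      have hdiff : ((l : ℝ) + 1) / 24 - 1 / (2 * l) - ((l : ℝ) + 1) / 4 * (1 / 6 * (1 - 12 / ((l : ℝ) ^ 2)))
          = 1 / (2 * (l : ℝ) ^ 2) := by
        field_simp
        ring
      have hpos : (0 : ℝ) ≤ 1 / (2 * (l : ℝ) ^ 2) := by positivity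
      linarith
    have h2 : ((l : ℝ) + 1) / 4 * (1 / 6 * (1 - 12 / ((l : ℝ) ^ 2)) * Cor22.logQAvoid P {2, l}) ≤
        (((l : ℝ) + 1) / 24 - 1 / (2 * l)) * Cor22.logQAvoid P {2, l} := by
      calc ((l : ℝ) + 1) / 4 * (1 / 6 * (1 - 12 / ((l : ℝ) ^ 2)) * Cor22.logQAvoid P {2, l})
          = ((l : ℝ) + 1) / 4 * (1 / 6 * (1 - 12 / ((l : ℝ) ^ 2))) * Cor22.logQAvoid P {2, l} := by ring
        _ ≤ (((l : ℝ) + 1) / 24 - 1 / (2 * l)) * Cor22.logQAvoid P {2, l} :=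
          mul_le_mul_of_nonneg_right hcoef hq.le
    have h3 : 1 / 6 * (1 - 12 / ((l : ℝ) ^ 2)) * Cor22.logQAvoid P {2, l} ≤
        (1 + 12 * (Cor22.dmod P : ℝ) / l) * (P.logDiff + Cor22.logCondAvoid P {2, l})
          + 2 * Real.log l + 52
          + 20 / 3 * Real.log (((2 ^ 12 * 3 ^ 3 * 5 * Cor22.dmod P : ℕ) : ℝ) * (l : ℝ))
            * (Nat.primeCounting (2 ^ 12 * 3 ^ 3 * 5 * Cor22.dmod P * l) : ℝ) + 4
          + 2 / 3 * ((((2 ^ 12 * 3 ^ 3 * 5 * Cor22.dmod P : ℕ) : ℝ)) * l) :=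
      le_of_mul_le_mul_left (le_trans h2 h1) hc
    have hE : (0 : ℝ) ≤ (((2 ^ 12 * 3 ^ 3 * 5 * Cor22.dmod P : ℕ) : ℝ)) * l + η := by positivity
    have hpnt' : 20 / 3 * Real.log (((2 ^ 12 * 3 ^ 3 * 5 * Cor22.dmod P : ℕ) : ℝ) * (l : ℝ))
        * (Nat.primeCounting (2 ^ 12 * 3 ^ 3 * 5 * Cor22.dmod P * l) : ℝ) ≤
        20 / 3 * (4 / 3 * ((((2 ^ 12 * 3 ^ 3 * 5 * Cor22.dmod P : ℕ) : ℝ)) * l + η)) := by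
      rw [mul_assoc]
      exact mul_le_mul_of_nonneg_left hpnt (by norm_num)
    -- name the (nonlinear) atoms so that the final step is visibly linear
    set W : ℝ := 20 / 3 * Real.log (((2 ^ 12 * 3 ^ 3 * 5 * Cor22.dmod P : ℕ) : ℝ) * (l : ℝ))
        * (Nat.primeCounting (2 ^ 12 * 3 ^ 3 * 5 * Cor22.dmod P * l) : ℝ) with hW
    set E : ℝ := (((2 ^ 12 * 3 ^ 3 * 5 * Cor22.dmod P : ℕ) : ℝ)) * l + η with hEdef
    set E₀ : ℝ := (((2 ^ 12 * 3 ^ 3 * 5 * Cor22.dmod P : ℕ) : ℝ)) * l with hE₀def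
    set A : ℝ := (1 + 12 * (Cor22.dmod P : ℝ) / l) * (P.logDiff + Cor22.logCondAvoid P {2, l}) with hA
    set Q : ℝ := 1 / 6 * (1 - 12 / ((l : ℝ) ^ 2)) * Cor22.logQAvoid P {2, l} with hQ
    set G : ℝ := Real.log (l : ℝ) with hG
    linarith [hpnt', habs, h3, hE, hE0le]
  -- `C_Θ ≥ −1`
  have hC : -1 ≤ X.CTheta := by
    unfold Thm110Numerics.CTheta
    have hq' := X.absLogq_pos
    have hl5 := X.five_le_l_real
    have : 0 ≤ ((X.l : ℝ) + 1) / (4 * X.absLogq) * X.bracket := mul_nonneg (by positivity) hbr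
    linarith
  exact Cor22.display_of_numerics X rfl rfl rfl rfl rfl rfl (Thm110Numerics.display_of_neg_one_le_CTheta h7 hC)


/-! ## §3. To `Thm110Legendre`, to the crux `ThetaPartII`, to `ABC` -/

/-- **`Cor22.Thm110Legendre` from the squeeze (constant `B_III`) WEAKENED BY `τ(P, l)` at every admissible point** — binders exactly
those of `Cor22.Thm110Legendre` (`l ≠ 5` by abc-iut-S-d2's `thm110Legendre_of_pointwise`). CONDITIONAL on `hsq`. [claim: Mochizuki2012, status: disputed] -/
theorem thm110Legendre_of_squeezeIII_upTo
    (hsq : ∀ P : NFPoint, P ∈ UP → ∀ l : ℕ, l.Prime → 5 ≤ l →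
      Cor22.AdmitsCore P → Cor22.CondP2 P l → Cor22.CondP5 P l → Cor22.CondP6 P l →
      (((l : ℝ) + 1) / 24 - 1 / (2 * l)) * Cor22.logQAvoid P {2, l} ≤
        ((l : ℝ) + 1) / 4 *
          ((1 + 12 * (Cor22.dmod P : ℝ) / l) * (P.logDiff + Cor22.logCondAvoid P {2, l})
            + 2 * Real.log l + 52
            + 20 / 3 * Real.log (((2 ^ 12 * 3 ^ 3 * 5 * Cor22.dmod P : ℕ) : ℝ) * (l : ℝ))
              * (Nat.primeCounting (2 ^ 12 * 3 ^ 3 * 5 * Cor22.dmod P * l) : ℝ))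
        + ThetaVolumeInput.archLogTheta l + displayTolerance P l) :
    Cor22.Thm110Legendre :=
  thm110Legendre_of_pointwise fun _ hη P hP l hl h5 hne hcore hP2 hP5 hP6 =>
    display_of_squeezeIII_upTo hl h5 hne hη le_rfl (hsq P hP l hl h5 hcore hP2 hP5 hP6)

/-- **The crux `ThetaPartII` (stmt-ABC-19678) BY NAME from the squeeze weakened by `τ(P, l)`** — abc-iut-S3's
`Cor22.exists_partII_of_thm110Legendre` + the PROVED `Cor22.fullGaloisImage_holds`. CONDITIONAL; does not close the item.
[claim: Mochizuki2012, status: disputed] -/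
theorem ThetaPartII_of_squeezeIII_upTo
    (hsq : ∀ P : NFPoint, P ∈ UP → ∀ l : ℕ, l.Prime → 5 ≤ l →
      Cor22.AdmitsCore P → Cor22.CondP2 P l → Cor22.CondP5 P l → Cor22.CondP6 P l →
      (((l : ℝ) + 1) / 24 - 1 / (2 * l)) * Cor22.logQAvoid P {2, l} ≤
        ((l : ℝ) + 1) / 4 *
          ((1 + 12 * (Cor22.dmod P : ℝ) / l) * (P.logDiff + Cor22.logCondAvoid P {2, l})
            + 2 * Real.log l + 52
            + 20 / 3 * Real.log (((2 ^ 12 * 3 ^ 3 * 5 * Cor22.dmod P : ℕ) : ℝ) * (l : ℝ))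
              * (Nat.primeCounting (2 ^ 12 * 3 ^ 3 * 5 * Cor22.dmod P * l) : ℝ))
        + ThetaVolumeInput.archLogTheta l + displayTolerance P l) :
    Summit.ABC.ABC.Theses.IUTThetaPilot.ThetaPartII := by
  unfold Summit.ABC.ABC.Theses.IUTThetaPilot.ThetaPartII
  exact Cor22.exists_partII_of_thm110Legendre (thm110Legendre_of_squeezeIII_upTo hsq) Cor22.fullGaloisImage_holds

/-- **`ABC` FROM «COROLLARY 3.12 UP TO `τ(P, l)`» AT EVERY GENUINE Θ-VOLUME DATUM** (and the off-regime hull estimate of record): if at every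
admissible `(P, l)` of the `λ`-line and every genuine Θ-volume datum `T` there, `−|log(q)| − τ(P, l) ≤ −|log(Θ)|` (xi-1's shape, HYPOTHESIS),
and `hreg` (VERBATIM the binder of abc-iut-c312-8's `ThetaPartII.ABC_of_cor312_of_hullRegime`; (R4) + the slot-constant hull estimate are theorems,
`ThetaPartII.hullVolume_of_hullRegime`), then `ABC` — via xi-1's squeeze with the error `logQAvoid_le_of_cor312UpTo`, Step (viii) with slack
(`display_of_squeezeIII_upTo`), Cor. 2.2 (ii), and the route's `closes` with the PROVED `genEllTwo_holds`, `JInvWlog_proof`. This is the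
certificate of record with a STRICTLY WEAKER upstream hypothesis (`T.Cor312Of ⟹ T.negAbsLogQ − τ ≤ T.negLogTheta`, `τ ≥ 0`). R-H ROUND 2 Q2 reading: «S_H on
Σ_row» supplies «Cor. 3.12 up to `D_off(Σ_row)`», so abc follows with print's constants whenever `D_off(Σ_row) ≤ τ(P, l)`. CONDITIONAL;
nothing asserted; no side taken. [cite: Mochizuki2012, IUTchIV Thm. 1.10, Cor. 2.2 (ii), Cor. 2.3 pp. 22–55] [claim: Mochizuki2012, status: disputed] -/
theorem ABC_of_cor312UpTo_of_hullRegime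
    (h312 : ∀ P : NFPoint, P ∈ UP → ∀ l : ℕ, l.Prime → 5 ≤ l →
      Cor22.AdmitsCore P → Cor22.CondP2 P l → Cor22.CondP5 P l → Cor22.CondP6 P l →
      ∀ T : Cor22.ThetaVolumeDatumAt P l, T.negAbsLogQ - displayTolerance P l ≤ T.negLogTheta)
    (hreg : ∀ P : NFPoint, P ∈ UP → ∀ l : ℕ, l.Prime → 5 ≤ l →
      Cor22.AdmitsCore P → Cor22.CondP2 P l → Cor22.CondP5 P l → Cor22.CondP6 P l →
      ∀ T : Cor22.ThetaVolumeDatumAt P l,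
        (letI := T.instFieldF; letI := T.instNumberFieldF; letI := T.instAlgebraF; letI := T.instFieldK
         letI := T.instNumberFieldK; letI := T.instAlgebraK; letI := T.instFieldFbar; letI := T.instAlgebraFbar
         letI := T.instAlgebraKFbar; letI := T.instIsElliptic
         ¬ (∀ p ∈ T.I.supportPrimes, ∀ v w : placesOver (fieldOfModuli T.E) p,
            (Summit.ABC.IUTFork.DHData.ofInput T.I).logQloc p v = (Summit.ABC.IUTFork.DHData.ofInput T.I).logQloc p w)) →
        T.HullEstimateOf
          (((l : ℝ) + 1) / 4 *
            ((1 + 12 * (Cor22.dmod P : ℝ) / l) * (P.logDiff + Cor22.logCondAvoid P {2, l})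
              + 2 * Real.log l + 52
              + 20 / 3 * Real.log (((2 ^ 12 * 3 ^ 3 * 5 * Cor22.dmod P : ℕ) : ℝ) * (l : ℝ))
                * (Nat.primeCounting (2 ^ 12 * 3 ^ 3 * 5 * Cor22.dmod P * l) : ℝ)))) :
    _root_.ABC :=
  Summit.ABC.ABC.Theses.IUTThetaPilot.closes
    (ThetaPartII_of_squeezeIII_upTo fun P hP l hl h5 hcore hP2 hP5 h6 => by
      obtain ⟨T⟩ := ThetaPartII.stub_thetaData P hP l hl h5 hcore hP2 hP5 h6
      have h := logQAvoid_le_of_cor312UpTo T hP.1 (h312 P hP l hl h5 hcore hP2 hP5 h6 T)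
        (ThetaPartII.hullVolume_of_hullRegime hreg P hP l hl h5 hcore hP2 hP5 h6 T)
      linarith)
    genEllTwo_holds JInvWlog_proof

/-- **In xi-1's currency — the ADDITIVE tolerance `A = τ(P, l)` (`κ = 0`) is FREE**: if at every admissible `(P, l)` and every genuine Θ-volume
datum `T` there is an off-Σ bound `B` with «Cor. 3.12 up to `B`» (`T.negAbsLogQ − B ≤ T.negLogTheta`) and `OffSigmaTolerance 0 (τ(P,l)) T B`
(`B ≤ τ(P, l)`), then — with `hreg` of record — `ABC`, constants UNCHANGED. This is the «κ = 0, `A` of print's shape» end of xi-1's §3 for every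
`A ≤ τ`: no re-entry into `B_III` is needed below the display tolerance. CONDITIONAL; nothing asserted. [claim: Mochizuki2012, status: disputed] -/
theorem ABC_of_offSigmaTolerance_zero_of_hullRegime
    (h312 : ∀ P : NFPoint, P ∈ UP → ∀ l : ℕ, l.Prime → 5 ≤ l →
      Cor22.AdmitsCore P → Cor22.CondP2 P l → Cor22.CondP5 P l → Cor22.CondP6 P l →
      ∀ T : Cor22.ThetaVolumeDatumAt P l, ∃ B : ℝ,
        T.negAbsLogQ - B ≤ T.negLogTheta ∧ OffSigmaTolerance 0 (displayTolerance P l) T B)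
    (hreg : ∀ P : NFPoint, P ∈ UP → ∀ l : ℕ, l.Prime → 5 ≤ l →
      Cor22.AdmitsCore P → Cor22.CondP2 P l → Cor22.CondP5 P l → Cor22.CondP6 P l →
      ∀ T : Cor22.ThetaVolumeDatumAt P l,
        (letI := T.instFieldF; letI := T.instNumberFieldF; letI := T.instAlgebraF; letI := T.instFieldK
         letI := T.instNumberFieldK; letI := T.instAlgebraK; letI := T.instFieldFbar; letI := T.instAlgebraFbar
         letI := T.instAlgebraKFbar; letI := T.instIsElliptic
         ¬ (∀ p ∈ T.I.supportPrimes, ∀ v w : placesOver (fieldOfModuli T.E) p,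
            (Summit.ABC.IUTFork.DHData.ofInput T.I).logQloc p v = (Summit.ABC.IUTFork.DHData.ofInput T.I).logQloc p w)) →
        T.HullEstimateOf
          (((l : ℝ) + 1) / 4 *
            ((1 + 12 * (Cor22.dmod P : ℝ) / l) * (P.logDiff + Cor22.logCondAvoid P {2, l})
              + 2 * Real.log l + 52
              + 20 / 3 * Real.log (((2 ^ 12 * 3 ^ 3 * 5 * Cor22.dmod P : ℕ) : ℝ) * (l : ℝ))
                * (Nat.primeCounting (2 ^ 12 * 3 ^ 3 * 5 * Cor22.dmod P * l) : ℝ)))) :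
    _root_.ABC :=
  ABC_of_cor312UpTo_of_hullRegime (fun P hP l hl h5 hcore hP2 hP5 h6 T => by
    obtain ⟨B, hB, htol⟩ := h312 P hP l hl h5 hcore hP2 hP5 h6 T
    rw [offSigmaTolerance_zero_displayTolerance_iff] at htol
    linarith) hreg

end Summit.ABC.IUTFork.Repair.RH.OffSigmaDisplay

end
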